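import Summits.ResolutionOfSingularities.KangarooAtlas.MizutaniSpreadCoeff
import Summits.ResolutionOfSingularities.KangarooAtlas.MizutaniProfile
import Mathlib.Algebra.Polynomial.Roots
import HarnessLib

/-!
# Mizutani's conjecture `m(e) = 2p^e − 1` — SPREADING, IV: support control and the move-closed spread

Cell topic `Summits/ResolutionOfSingularities/KangarooAtlas` (pub-rosobs); namespace
`Summit.ResolutionOfSingularities.KangarooAtlas.Mizutani`.  Part of the Lean transcription of the
in-house note MIZUTANI-PROOF-g59 (AI-written, AI-audited; *AI review is weaker than expert review*; not a
resolution theorem).  Encloser-1 ARCH-e1 (S1) and the iteration (the note's §5 Thm D″ "`supp(A·ω) =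
Red(S)` for generic `A`", one elementary substitution at a time):

* `exists_legal_of_mem_support` — every monomial of `trunc (θ_β f)` is a LEGAL MOVE of a monomial of `f`
  (any `β`);
* `exists_generic` — a `β` in the infinite subring `L` outside the roots of the finitely many spread
  polynomials of the box; for such `β`, `supp f ⊆ supp (trunc (θ_β f))` and every legal move `move_{j→i,u} M`
  of a monomial `M` of `f` is a monomial of `trunc (θ_β f)` (`exists_spread_step`);
* **`exists_moveClosed_spread`** — iterating: from `(f, D)` with box-supported admissible support one reaches
  `(f*, D*)` with MOVE-CLOSED admissible support `⊇ supp f`, the same kind of operator family, and profiles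
  `σ^{D*}_r(f*) ≤ σ^D_r(f)` for `r + 1 ≤ q`.

References: [Mizutani1973HironakaGroupSchemes] (Remark 2.10; in-house proof §5 Thm D″).
-/

open MvPolynomial Literature.AlgebraicGeometry.Resolution

namespace Summit.ResolutionOfSingularities.KangarooAtlas.Mizutani

section Support

variable {ι : Type*} [Fintype ι] [DecidableEq ι] {k : Type*} [Field k] {p e : ℕ} [Fact p.Prime] [CharP k p]

omit [Fact p.Prime] [CharP k p] in
/-- Coefficients of the spread-and-truncated element. [cite: Mizutani1973HironakaGroupSchemes, Remark 2.10 (in-house proof §5 Thm D″)] -/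
theorem coeff_trunc_theta {j i : ι} (hji : j ≠ i) (β : k) (f : MvPolynomial ι k) (N : ι →₀ ℕ) :
    coeff N (trunc (p ^ e) (theta j i β f)) =
      if InBox (p ^ e) N then (spreadPoly j i f N).eval β else 0 := by
  rw [coeff_trunc, eval_spreadPoly j i hji]

omit [Fact p.Prime] in
/-- **Every monomial of `trunc (θ_β f)` is a legal move of a monomial of `f`** (any `β`).
[cite: Mizutani1973HironakaGroupSchemes, Remark 2.10 (in-house proof §5 Thm D″: supp(A·ω) ⊆ Red(S))] -/
theorem exists_legal_of_mem_support {j i : ι} (hji : j ≠ i) (β : k) (f : MvPolynomial ι k)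
    {N : ι →₀ ℕ} (hN : N ∈ (trunc (p ^ e) (theta j i β f)).support) :
    ∃ M ∈ f.support, ∃ u : ℕ, LegalMove p (p ^ e) M j i u ∧ move j i u M = N := by
  have hbox : InBox (p ^ e) N := inBox_of_mem_support_trunc _ _ hN
  rw [mem_support_iff, coeff_trunc_theta hji, if_pos hbox] at hN
  -- some coefficient of the spread polynomial is non-zero
  have hP : spreadPoly j i f N ≠ 0 := fun h => hN (by rw [h, Polynomial.eval_zero])
  obtain ⟨u, hu⟩ : ∃ u, (spreadPoly j i f N).coeff u ≠ 0 := by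
    by_contra hall
    push Not at hall
    exact hP (Polynomial.ext fun u => by rw [hall u, Polynomial.coeff_zero])
  rw [coeff_spreadPoly] at hu
  split_ifs at hu with hui
  · set M := N + Finsupp.single j u - Finsupp.single i u with hM
    have hMf : M ∈ f.support := by
      rw [mem_support_iff]; exact left_ne_zero_of_mul hu
    have hMj : M j = N j + u := by rw [hM, inverseMove_apply_j hji]
    have hMi : M i = N i - u := by rw [hM, inverseMove_apply hji, if_neg hji.symm, if_pos rfl]
    have hnd : ¬ p ∣ (M j).choose u := by
      intro hdvd
      apply right_ne_zero_of_mul hu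
      rw [← hMj, (CharP.cast_eq_zero_iff k p _).mpr hdvd]
    refine ⟨M, hMf, u, ⟨hji, hnd, ?_⟩, (move_eq_iff hji M N u (by rw [hMj]; omega)).mpr ⟨hM, hui⟩⟩
    rw [hMi]
    have := hbox i
    omega
  · exact absurd rfl hu

/-- The box as a finite set of exponent vectors. [folklore] -/
noncomputable def boxFinset (ι : Type*) [Fintype ι] [DecidableEq ι] (q : ℕ) : Finset (ι →₀ ℕ) :=
  Finset.univ.image (Box.toF : Box ι q → ι →₀ ℕ)

/-- Membership in the box finset. [folklore] -/
theorem mem_boxFinset {q : ℕ} {N : ι →₀ ℕ} : N ∈ boxFinset ι q ↔ InBox q N := by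
  unfold boxFinset
  rw [Finset.mem_image]
  constructor
  · rintro ⟨M, _, rfl⟩; exact Box.inBox_toF M
  · intro h; exact ⟨Box.ofF N h, Finset.mem_univ _, Box.toF_ofF N h⟩

omit [Fact p.Prime] [CharP k p] in
/-- **A generic parameter**: in an infinite set of scalars there is `β` at which no non-zero spread
polynomial of the box vanishes. [cite: Mizutani1973HironakaGroupSchemes, Remark 2.10 (in-house proof §5 Thm D″: generic A outside a proper closed set)] -/
theorem exists_generic (L : Set k) (hL : L.Infinite) (j i : ι) (f : MvPolynomial ι k) :
    ∃ β ∈ L, ∀ N : ι →₀ ℕ, InBox (p ^ e) N → spreadPoly j i f N ≠ 0 → (spreadPoly j i f N).eval β ≠ 0 := by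
  classical
  obtain ⟨β, hβL, hβ⟩ := hL.exists_notMem_finset
    ((boxFinset ι (p ^ e)).biUnion fun N => (spreadPoly j i f N).roots.toFinset)
  refine ⟨β, hβL, fun N hN hP hev => hβ ?_⟩
  rw [Finset.mem_biUnion]
  refine ⟨N, mem_boxFinset.mpr hN, ?_⟩
  rw [Multiset.mem_toFinset, Polynomial.mem_roots hP]
  exact hev

/-- **One spreading step** (MIZUTANI-PROOF-g59 §5 Thm D″ for one elementary substitution): for box-supported
`f` and a generic `β ∈ L`, the element `f' = trunc (θ_β f)` has support containing `supp f` and every legal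
move `move_{j→i,u} M` of a monomial `M` of `f`; every monomial of `f'` is such a legal move.
[cite: Mizutani1973HironakaGroupSchemes, Remark 2.10 (in-house proof §5 Thm D″)] -/
theorem exists_spread_step (L : Set k) (hL : L.Infinite) {j i : ι} (hji : j ≠ i) (f : MvPolynomial ι k)
    (hbox : ∀ M ∈ f.support, InBox (p ^ e) M) :
    ∃ β ∈ L, f.support ⊆ (trunc (p ^ e) (theta j i β f)).support ∧
      (∀ M ∈ f.support, ∀ u, LegalMove p (p ^ e) M j i u →
        move j i u M ∈ (trunc (p ^ e) (theta j i β f)).support) := by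
  obtain ⟨β, hβL, hβ⟩ := exists_generic (p := p) (e := e) L hL j i f
  have key : ∀ M ∈ f.support, ∀ u, LegalMove p (p ^ e) M j i u →
      move j i u M ∈ (trunc (p ^ e) (theta j i β f)).support := by
    intro M hM u hleg
    have hu : u ≤ M j := le_of_not_dvd_choose hleg.not_dvd
    set N := move j i u M with hN
    have hNbox : InBox (p ^ e) N := inBox_move (hbox M hM) hleg
    have hinv := (move_eq_iff hji M N u hu).mp rfl
    rw [mem_support_iff, coeff_trunc_theta hji, if_pos hNbox]
    refine hβ N hNbox fun h0 => ?_
    have hc := congrArg (fun P => P.coeff u) h0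
    simp only [coeff_spreadPoly, Polynomial.coeff_zero, if_pos hinv.2] at hc
    rw [← hinv.1] at hc
    refine (mul_ne_zero (mem_support_iff.mp hM) ?_) hc
    have hMj : N j + u = M j := by rw [hinv.1, inverseMove_apply_j hji]
    rw [hMj, Ne, CharP.cast_eq_zero_iff k p]
    exact hleg.not_dvd
  refine ⟨β, hβL, fun M hM => ?_, key⟩
  -- `M` itself is the trivial move `u = 0`
  have h0 : LegalMove p (p ^ e) M j i 0 :=
    ⟨hji, by rw [Nat.choose_zero_right]; exact (Fact.out : p.Prime).not_dvd_one, by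
      rw [add_zero]; exact hbox M hM i⟩
  have := key M hM 0 h0
  rwa [show move j i 0 M = M from by ext l; rw [move_apply hji]; split_ifs <;> simp_all] at this

end Support

/-! ## Iterating to a move-closed support -/

section Closure

variable {ι : Type*} [Fintype ι] [DecidableEq ι] {k : Type*} [Field k] {p e : ℕ} [Fact p.Prime] [CharP k p]

/-- The operator families the induction runs over: additive `D_T` with `D_0 = id`, linear over the subring `L`
of "constants" (in a tower: the Hasse–Schmidt operators of a `p`-basis, `L` the ground field).
[cite: Mizutani1973HironakaGroupSchemes, Remark 2.10 (in-house proof §1.4: the D^{(T)} are L-linear, D^{(0)} = id)] -/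
structure GoodOps (L : Subring k) (D : (ι →₀ ℕ) → k →+ k) : Prop where
  /-- `D_0 = id` -/
  zero : D 0 = AddMonoidHom.id k
  /-- the operators commute with the constants -/
  mul : ∀ c ∈ L, ∀ T x, D T (c * x) = c * D T x

/-- `recombD` preserves `GoodOps`. [folklore] -/
theorem GoodOps.recombD {L : Subring k} {D : (ι →₀ ℕ) → k →+ k} (hD : GoodOps L D) (j i : ι) (β : k) :
    GoodOps L (recombD j i β D) :=
  ⟨recombD_zero j i β D hD.zero, fun c hc T x => recombD_mul j i β D (hD.mul c hc) T x⟩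

/-- **The move-closed spread** (MIZUTANI-PROOF-g59 §5 Thm D″ + encloser-1 ARCH-e1 (S)): from a box-supported
`f` whose monomials have degree `≥ q` one reaches, by finitely many generic elementary substitutions and
truncations, an element `f*` (with a recombined operator family `D*` of the same kind) whose support is
MOVE-CLOSED, still in the box with degrees `≥ q`, contains `supp f`, and whose profiles are not larger.
[cite: Mizutani1973HironakaGroupSchemes, Remark 2.10 (in-house proof §5 Thm D″, §7 proof of Thm E(s): "ω₁ := A·ω_c")] -/
theorem exists_moveClosed_spread (L : Subring k) (hL : (L : Set k).Infinite) :
    ∀ (n : ℕ) (D : (ι →₀ ℕ) → k →+ k) (f : MvPolynomial ι k), GoodOps L D →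
      (∀ M ∈ f.support, InBox (p ^ e) M ∧ p ^ e ≤ M.degree) →
      (boxFinset ι (p ^ e)).card ≤ f.support.card + n →
      ∃ (D' : (ι →₀ ℕ) → k →+ k) (f' : MvPolynomial ι k), GoodOps L D' ∧
        (∀ M ∈ f'.support, InBox (p ^ e) M ∧ p ^ e ≤ M.degree) ∧
        MoveClosed p (p ^ e) f'.support ∧ f.support ⊆ f'.support ∧
        ∀ r, r + 1 ≤ p ^ e → eProfile D' r f' ≤ eProfile D r f := by
  intro n
  induction n with
  | zero =>
    intro D f hD hadm hcard
    -- the support fills the box: then it is trivially move-closed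
    refine ⟨D, f, hD, hadm, fun M hM j i u hleg => ?_, subset_rfl, fun r _ => le_rfl⟩
    have hsub : f.support ⊆ boxFinset ι (p ^ e) := fun M hM => mem_boxFinset.mpr (hadm M hM).1
    have heq : f.support = boxFinset ι (p ^ e) := Finset.eq_of_subset_of_card_le hsub (by omega)
    rw [heq, mem_boxFinset]
    exact inBox_move (hadm M hM).1 hleg
  | succ n ih =>
    intro D f hD hadm hcard
    by_cases hclosed : MoveClosed p (p ^ e) f.support
    · exact ⟨D, f, hD, hadm, hclosed, subset_rfl, fun r _ => le_rfl⟩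
    · unfold MoveClosed at hclosed
      push Not at hclosed
      obtain ⟨M, hM, j, i, u, hleg, hnot⟩ := hclosed
      have hbox : ∀ M ∈ f.support, InBox (p ^ e) M := fun M hM => (hadm M hM).1
      obtain ⟨β, hβL, hsub, hmoves⟩ := exists_spread_step (p := p) (e := e) (L : Set k) hL hleg.ne f hbox
      set f₁ := trunc (p ^ e) (theta j i β f) with hf₁
      have hadm₁ : ∀ N ∈ f₁.support, InBox (p ^ e) N ∧ p ^ e ≤ N.degree := by
        intro N hN
        obtain ⟨M', hM', u', hleg', rfl⟩ := exists_legal_of_mem_support hleg.ne β f hN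
        exact ⟨inBox_move (hadm M' hM').1 hleg', by rw [degree_move hleg'.ne (le_of_not_dvd_choose hleg'.not_dvd)]; exact (hadm M' hM').2⟩
      have hlt : f.support.card < f₁.support.card :=
        Finset.card_lt_card ⟨hsub, fun h => hnot (h (hmoves M hM u hleg))⟩
      obtain ⟨D', f', hD', hadm', hclosed', hsub', hprof'⟩ :=
        ih (recombD j i β D) f₁ (hD.recombD j i β) hadm₁ (by omega)
      refine ⟨D', f', hD', hadm', hclosed', hsub.trans hsub', fun r hr => (hprof' r hr).trans ?_⟩
      exact eProfile_trunc_theta_le j i L hβL D hD.mul hr f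

end Closure

end Summit.ResolutionOfSingularities.KangarooAtlas.Mizutani
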